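import Summits.BirchSwinnertonDyer.Rank1Residual.X11b.RouteR1IntReceptacle
import Literature.NumberTheory.EllipticCurves.RankinSelbergGenusTwist
import Literature.NumberTheory.EllipticCurves.BDPBranchPAdicLFunction
import Literature.NumberTheory.EllipticCurves.DeShalit1987.KatzMeasureMonomialLinesFrames
import Literature.NumberTheory.EllipticCurves.DeShalit1987.KatzMeasureMonomialLines
import HarnessLib

/-!
# Route `SchneiderFreeAdditiveX3` (K1 door) / its wing: the MATCHING of a Castella–Hsieh BRANCH frame of the good member `f̃`
# with a ♭-frame of `f = f̃ ⊗ ε` REDUCES to one multiplier identity (the interpolation of `e·φ(𝔮)⁻²` along the family)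

Cell `bsd-schneider-ideate`, seat `bsd-schneider-door-c5` (prover, generation 19; assembly layer).  PARTITION: board row
B6 ∩ X3 ∩ sst-twist, `r = 1`, (G-ord, `e = 2`) half, of `Rank1Residual.partition`; types-the-object-of nothing new; closes none of
B6's cells.  bears_on: K1-door r3 `GordTwoBranchIMC` (19177) and K1-wing r3 `GordTwoBranchCoIMCField` (20365) — FINDING-door-c5-g19 §2b.

THE POINT.  Keller–Yin's Theorem 3.5.1 in branch currency (`KellerYin2024.thm351_charIdeal_eq_branch_OPEN`, PREPRINT) speaks about
Castella–Hsieh BRANCH frames `IsBranchBDPLFunction ι 𝔮 κ γ f′ χ_ε e Ω_K Ω_p L` of the good-ordinary member `f′ = f̃` of the Heegner pair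
(value at `φ`: `ι⁻¹(Γ(n)Γ(n+1)·e·φ(𝔮)⁻²·L(f̃/K, χ_ε φ, 1)/(π^{2n+1}Ω_K^{4n}))·Ω_p^{4n}`), whereas the ♭-sockets of the door and the wing
at the conjugate prime (`…BranchSocketConjFrame`, `…UpperCoSocketConjFrame`, this seat) consume ♭-frames
`X11b.R1.IsBDPLFunctionInt p ι 𝔮 κ γ f Ω_K Ω_p′ Q` of the newform `f = f_E = f̃ ⊗ ε` itself (value `ι⁻¹(Γ(n)Γ(n+1)·L(f/K, φ, 1)/(…))·Ω_p′^{4n}`,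
the Euler-type factor being `1` since `a_p(f) = 0`, `p ∣ N`).  By the twist identity `L(f̃/K, χ_ε φ, 1) = L(f/K, φ, 1)`
(`rankinSelbergValueHecke_genusTwist_eq`, this seat, p633239) the two prescribed values differ EXACTLY by the multiplier
`ι⁻¹(e·φ(𝔮)⁻²)` and the period ratio.  Hence:

* §1 `isBDPLFunctionInt_mul_map_of_isBranchBDPLFunction_of_multiplier` — if a series `U ∈ 𝓞_{ℂ_p}⟦T⟧` interpolates the inverse
  multiplier times the period shift, i.e. at every character of the range `U(φ̂(γ) − 1) = w` with
  `w · ι⁻¹(e·φ(𝔮)⁻²) · Ω_p^{4n} = Ω_p′^{4n}` (displayed hypothesis `hU` — the ONE analytic identity left; expected witness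
  `U = ι⁻¹(e)⁻¹·(1+T)^a`, `Ω_p′ = Ω_p·p^{±1/2}`, from the local form of the `p`-adic avatar at `𝔮 ∣ p`, Serre 1968 II §2.7 — NOT in
  the tree), then `U · L` (read in `𝓞_{ℂ_p}⟦T⟧`) IS a ♭-frame of `f` at `(ι, 𝔮)` with periods `(Ω_K, Ω_p′)`.
* §2 the ideal bookkeeping: `(U·L) ⊆ I` from `(L) ⊆ I`; `I ⊆ (U·L)` from `I ⊆ (L)` when `U` is a unit; an identity
  `Ch·R₀⟦T⟧ = (L₀)` over `R₀` (Keller–Yin's shape, `j = toUnr p`) pushed to `𝓞_{ℂ_p}⟦T⟧`.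
* §3 the packaged ∃-frame outputs in the exact shape of the conj-frame sockets' hypotheses (`…_of_exists_intDivConj`,
  `…_of_exists_intCoDivConj`): from a branch frame `L`, a unit multiplier series `U` with `hU`, and `Ch·R₀⟦T⟧ ⊆ (L)` (resp.
  `(L) ⊆ Ch·R₀⟦T⟧`) over `R₀`.

HONEST FRAMING: THEOREMS ONLY (no definition, no named fact, no `sorry`); pure algebra on the tree's predicates plus the landed twist
identity; the hypothesis `hU` is displayed, not asserted; Keller–Yin is a PREPRINT; nothing is closed; BSD is proved for no curve.
References: [CastellaHsieh2018] Def. 3.5, Prop. 3.6, §3.3 (e_𝔭); [Castella2018] Thm. 3.1; [KellerYin2024b] arXiv:2410.23241 §3.4 p. 19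
(𝓛_ε; preprint); [Hsieh2014] Thm. A (the receptacle); [Gross2004] §3 (the twist identity); [SerreAbelianLadic1968] Ch. II §2.7
(the expected source of `hU`).
-/

set_option autoImplicit false

noncomputable section

open scoped Classical NumberField

open Field NumberField IsDedekindDomain PowerSeries CongruenceSubgroup
  Literature.NumberTheory.EllipticCurves Literature.NumberTheory.GaloisRepresentations
  Literature.NumberTheory.EllipticCurves.ModularForms Literature.NumberTheory.EllipticCurves.KellerYin2024
  Summit.BirchSwinnertonDyer.Rank1Residual Summit.BirchSwinnertonDyer.Rank1Residual.X11b
  Summit.BirchSwinnertonDyer.Rank1Residual.X11b.Halves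

-- `Summit.<P>.<Sub>` repeats `BirchSwinnertonDyer` by the tree's layout convention (D-0017)
set_option linter.dupNamespace false

namespace Summit.BirchSwinnertonDyer.BirchSwinnertonDyer.Theorems.SchneiderFreeAdditiveX3.ControlDischarged

variable (K : Type) [Field K] [NumberField K] [IsGalois ℚ K] {p : ℕ} [Fact p.Prime]

/-! ### §1 Branch frame × multiplier series = ♭-frame of the twisted form -/

/-- **MATCH modulo the multiplier identity.** Let `f ∈ S₂(Γ₀(N))`, `f′ ∈ S₂(Γ₀(N′))` with `a_ℓ(f) = (ℓ/p)·a_ℓ(f′)` for every prime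
`ℓ ≠ p`, `a_p(f) = 0`, `p ∣ N`, equal prime support of the levels off `p` (`f = f′ ⊗ ε`), `p` odd and unramified in `K`.  Let `L` be a
Castella–Hsieh BRANCH frame of `(f′, χ_ε, e, Ω_K, Ω_p)` at `(ι, 𝔮, κ, γ)` and `U ∈ 𝓞_{ℂ_p}⟦T⟧` a series whose value at every
interpolation point satisfies `U(φ̂(γ)−1) · ι⁻¹(e·φ(𝔮)⁻²) · Ω_p^{4n} = Ω_p′^{4n}`.  Then `U · L` is a ♭-frame of `f` at `(ι, 𝔮, κ, γ)`
with periods `(Ω_K, Ω_p′)`: at each `φ` the branch value is `ι⁻¹(e·φ(𝔮)⁻²)` times Castella's value for `f` (twist identity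
`rankinSelbergValueHecke_genusTwist_eq`; Euler-type factor `1`), and evaluation on the open disc is multiplicative.
CONDITIONAL on the displayed `hU`; nothing asserted about any curve. [cite: CastellaHsieh2018, Def. 3.5, Prop. 3.6 and §3.3]
[cite: Castella2018, Thm. 3.1 (arXiv:1704.06608 p. 9)] [cite: Gross2004, §3 (p. 40)] -/
theorem isBDPLFunctionInt_mul_map_of_isBranchBDPLFunction_of_multiplier (hp2 : p ≠ 2)
    (hK : Algebra.IsUnramifiedIn (𝓞 K) (Ideal.span {(p : ℤ)}))
    {N N' : ℕ} (f : CuspForm (Gamma0 N) 2) (f' : CuspForm (Gamma0 N') 2)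
    (hcoef : ∀ ℓ : ℕ, ℓ.Prime → ℓ ≠ p → cuspCoeff f ℓ = ((legendreSym p ℓ : ℤ) : ℂ) * cuspCoeff f' ℓ)
    (hap : cuspCoeff f p = 0) (hpN : p ∣ N) (hlev : ∀ ℓ : ℕ, ℓ.Prime → ℓ ≠ p → (ℓ ∣ N ↔ ℓ ∣ N'))
    {ι : PadicAlgCl p ≃+* ℂ} {𝔮 : HeightOneSpectrum (𝓞 K)} {κ : ZpExtension K p} {γ : Field.absoluteGaloisGroup K}
    (hγ : κ.IsTopGenerator γ) {e ΩK : ℂ} {Ωp Ωp' : ℂ_[p]} {L : UnrSeries p} {U : PowerSeries 𝓞_ℂ_[p]}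
    (hL : IsBranchBDPLFunction ι 𝔮 κ γ f' (genusHeckeCharacter K p) e ΩK Ωp L)
    (hU : ∀ (φ : HeckeCharacter K) (n : ℕ), 0 < n → (∀ v : HeightOneSpectrum (𝓞 K), φ.IsUnramifiedAt v) →
      φ.HasInfinityType (fun _ ↦ (n : ℤ)) (fun _ ↦ -(n : ℤ)) →
      ∀ r : FramedGaloisRep K (PadicAlgCl p) 1, IsPAdicAvatarOf ι φ r → FactorsThroughZp κ r →
        ∃ w : ℂ_[p], IntSeries.HasValueAt U (avatarValueAt r γ - 1) w ∧
          w * ((((ι.symm (e * (heckeValueExtZero φ 𝔮 ^ 2)⁻¹) : PadicAlgCl p)) : ℂ_[p]) * Ωp ^ (4 * n)) =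
            Ωp' ^ (4 * n)) :
    R1.IsBDPLFunctionInt p ι 𝔮 κ γ f ΩK Ωp' (U * PowerSeries.map (R1.unrToCpInt p) L) := by
  intro φ n hn hunr hinf r hr hκr
  obtain ⟨w, hw, hwrel⟩ := hU φ n hn hunr hinf r hr hκr
  have h1 : IntSeries.HasValueAt (PowerSeries.map (R1.unrToCpInt p) L) (avatarValueAt r γ - 1)
      ((((ι.symm (bdpBranchInterpolationValue f' 𝔮 (genusHeckeCharacter K p) e φ n ΩK)) : PadicAlgCl p) : ℂ_[p]) *
        Ωp ^ (4 * n)) :=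
    (R1.intSeries_hasValueAt_map_iff p L _ _).mpr (hL φ n hn hunr hinf r hr hκr)
  have hx : ‖avatarValueAt r γ - 1‖ < 1 := ZpExtension.norm_avatarValueAt_sub_one_lt hκr hγ
  have hmul := IntSeries.HasValueAt.mul hx hw h1
  -- the branch value is the multiplier times Castella's value for `f`
  have key : bdpBranchInterpolationValue f' 𝔮 (genusHeckeCharacter K p) e φ n ΩK =
      (e * (heckeValueExtZero φ 𝔮 ^ 2)⁻¹) * bdpInterpolationValue p f 𝔮 φ n ΩK := by
    rw [bdpBranchInterpolationValue, bdpInterpolationValue_of_dvd hpN, hap,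
      rankinSelbergValueHecke_genusTwist_eq K hp2 hK f f' hcoef hap hpN hlev hunr 1]
    ring
  convert hmul using 1
  rw [key, map_mul, UniformSpace.Completion.coe_mul]
  calc (((ι.symm (bdpInterpolationValue p f 𝔮 φ n ΩK)) : PadicAlgCl p) : ℂ_[p]) * Ωp' ^ (4 * n)
      = (((ι.symm (bdpInterpolationValue p f 𝔮 φ n ΩK)) : PadicAlgCl p) : ℂ_[p]) *
          (w * ((((ι.symm (e * (heckeValueExtZero φ 𝔮 ^ 2)⁻¹)) : PadicAlgCl p) : ℂ_[p]) * Ωp ^ (4 * n))) := by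
        rw [hwrel]
    _ = w * ((((ι.symm (e * (heckeValueExtZero φ 𝔮 ^ 2)⁻¹)) : PadicAlgCl p) : ℂ_[p]) *
          (((ι.symm (bdpInterpolationValue p f 𝔮 φ n ΩK)) : PadicAlgCl p) : ℂ_[p]) * Ωp ^ (4 * n)) := by ring

/-! ### §2 Ideal bookkeeping -/

variable {K}

/-- `(U·M) ⊆ I` as soon as `(M) ⊆ I`. [cite: Castella2018, Thm. 3.1 (arXiv:1704.06608 p. 9) (context only)] -/
theorem span_mul_le_of_span_le {R : Type*} [CommRing R] {U M : R} {I : Ideal R}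
    (h : Ideal.span {M} ≤ I) : Ideal.span {U * M} ≤ I :=
  (Ideal.span_singleton_le_iff_mem _).mpr (I.mul_mem_left U ((Ideal.span_singleton_le_iff_mem _).mp h))

/-- `I ⊆ (U·M)` as soon as `I ⊆ (M)` and `U` is a unit (`(U·M) = (M)`). [cite: Castella2018, Thm. 3.1 (arXiv:1704.06608 p. 9) (context only)] -/
theorem le_span_mul_of_le_span {R : Type*} [CommRing R] {U M : R} {I : Ideal R} (hU : IsUnit U)
    (h : I ≤ Ideal.span {M}) : I ≤ Ideal.span {U * M} := by
  rwa [Ideal.span_singleton_mul_left_unit hU]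

/-- **An identity over `R₀⟦T⟧` pushed to `𝓞_{ℂ_p}⟦T⟧`**: if `I·R₀⟦T⟧ = (L₀)` along `toUnr p` (Keller–Yin's `j`, `(XAc.charIdeal …).map`)
then `I·𝓞_{ℂ_p}⟦T⟧ = (L₀)` along `R1.toCpInt p` (`Ideal.map_map`, `R1.map_toCpInt_eq_comp`).
[cite: Castella2018Erratum, Thm. 1.1 (p. 1) (shape; under review)] -/
theorem map_toCpInt_eq_span_of_map_toUnr_eq_span {I : Ideal (IwasawaAlgebra p)} {L₀ : UnrSeries p}
    (h : I.map (PowerSeries.map (toUnr p)) = Ideal.span {L₀}) :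
    I.map (PowerSeries.map (R1.toCpInt p)) = Ideal.span {PowerSeries.map (R1.unrToCpInt p) L₀} := by
  rw [R1.map_toCpInt_eq_comp, ← Ideal.map_map, h, Ideal.map_span, Set.image_singleton]

/-- The `≤` forms of the previous transport (monotonicity of `Ideal.map`).
[cite: Castella2018Erratum, Thm. 1.1 (p. 1) (shape; under review)] -/
theorem map_toCpInt_le_span_of_map_toUnr_le_span {I : Ideal (IwasawaAlgebra p)} {L₀ : UnrSeries p}
    (h : I.map (PowerSeries.map (toUnr p)) ≤ Ideal.span {L₀}) :
    I.map (PowerSeries.map (R1.toCpInt p)) ≤ Ideal.span {PowerSeries.map (R1.unrToCpInt p) L₀} := by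
  rw [R1.map_toCpInt_eq_comp, ← Ideal.map_map]
  refine (Ideal.map_mono h).trans ?_
  rw [Ideal.map_span, Set.image_singleton]

/-- Dually: `(L₀) ≤ I·R₀⟦T⟧` gives `(L₀) ≤ I·𝓞_{ℂ_p}⟦T⟧`. [cite: Castella2018Erratum, Thm. 1.1 (p. 1) (shape; under review)] -/
theorem span_le_map_toCpInt_of_span_le_map_toUnr {I : Ideal (IwasawaAlgebra p)} {L₀ : UnrSeries p}
    (h : Ideal.span {L₀} ≤ I.map (PowerSeries.map (toUnr p))) :
    Ideal.span {PowerSeries.map (R1.unrToCpInt p) L₀} ≤ I.map (PowerSeries.map (R1.toCpInt p)) := by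
  rw [R1.map_toCpInt_eq_comp, ← Ideal.map_map]
  refine le_trans ?_ (Ideal.map_mono h)
  rw [Ideal.map_span, Set.image_singleton]

/-! ### §3 The packaged ∃-frame outputs (the conj-frame sockets' hypotheses) -/

variable (K)

/-- **∃-frame with the LOWER divisibility from a branch frame, a unit multiplier series and `I·R₀⟦T⟧ ⊆ (L)`** — the shape
`∃ Ω_K Ω_p Q, Ω_K ≠ 0 ∧ Ω_p ≠ 0 ∧ IsBDPLFunctionInt … f … Q ∧ I·𝓞 ⊆ (Q)` consumed by `…_of_exists_intDivConj` (door).  CONDITIONAL on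
`hU`; nothing asserted about any curve. [cite: CastellaHsieh2018, Prop. 3.6] [cite: Castella2018, Thm. 3.1 (arXiv:1704.06608 p. 9)] -/
theorem exists_intFrame_map_le_of_branchFrame_of_multiplier (hp2 : p ≠ 2)
    (hK : Algebra.IsUnramifiedIn (𝓞 K) (Ideal.span {(p : ℤ)}))
    {N N' : ℕ} (f : CuspForm (Gamma0 N) 2) (f' : CuspForm (Gamma0 N') 2)
    (hcoef : ∀ ℓ : ℕ, ℓ.Prime → ℓ ≠ p → cuspCoeff f ℓ = ((legendreSym p ℓ : ℤ) : ℂ) * cuspCoeff f' ℓ)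
    (hap : cuspCoeff f p = 0) (hpN : p ∣ N) (hlev : ∀ ℓ : ℕ, ℓ.Prime → ℓ ≠ p → (ℓ ∣ N ↔ ℓ ∣ N'))
    {ι : PadicAlgCl p ≃+* ℂ} {𝔮 : HeightOneSpectrum (𝓞 K)} {κ : ZpExtension K p} {γ : Field.absoluteGaloisGroup K}
    (hγ : κ.IsTopGenerator γ) {e ΩK : ℂ} {Ωp Ωp' : ℂ_[p]} {L : UnrSeries p} {U : PowerSeries 𝓞_ℂ_[p]}
    (hΩK : ΩK ≠ 0) (hΩp' : Ωp' ≠ 0) (hUu : IsUnit U)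
    (hL : IsBranchBDPLFunction ι 𝔮 κ γ f' (genusHeckeCharacter K p) e ΩK Ωp L)
    (hU : ∀ (φ : HeckeCharacter K) (n : ℕ), 0 < n → (∀ v : HeightOneSpectrum (𝓞 K), φ.IsUnramifiedAt v) →
      φ.HasInfinityType (fun _ ↦ (n : ℤ)) (fun _ ↦ -(n : ℤ)) →
      ∀ r : FramedGaloisRep K (PadicAlgCl p) 1, IsPAdicAvatarOf ι φ r → FactorsThroughZp κ r →
        ∃ w : ℂ_[p], IntSeries.HasValueAt U (avatarValueAt r γ - 1) w ∧
          w * ((((ι.symm (e * (heckeValueExtZero φ 𝔮 ^ 2)⁻¹) : PadicAlgCl p)) : ℂ_[p]) * Ωp ^ (4 * n)) =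
            Ωp' ^ (4 * n))
    {I : Ideal (IwasawaAlgebra p)} (hI : I.map (PowerSeries.map (toUnr p)) ≤ Ideal.span {L}) :
    ∃ (ΩK₀ : ℂ) (Ωp₀ : ℂ_[p]) (Q : PowerSeries 𝓞_ℂ_[p]), ΩK₀ ≠ 0 ∧ Ωp₀ ≠ 0 ∧
      R1.IsBDPLFunctionInt p ι 𝔮 κ γ f ΩK₀ Ωp₀ Q ∧ I.map (PowerSeries.map (R1.toCpInt p)) ≤ Ideal.span {Q} :=
  ⟨ΩK, Ωp', U * PowerSeries.map (R1.unrToCpInt p) L, hΩK, hΩp',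
    isBDPLFunctionInt_mul_map_of_isBranchBDPLFunction_of_multiplier K hp2 hK f f' hcoef hap hpN hlev hγ hL hU,
    le_span_mul_of_le_span hUu (map_toCpInt_le_span_of_map_toUnr_le_span hI)⟩

/-- **∃-frame with the UPPER co-divisibility from a branch frame, a multiplier series and `(L) ⊆ I·R₀⟦T⟧`** — the shape consumed by
`…_of_exists_intCoDivConj` (wing); here `U` need not be a unit.  CONDITIONAL on `hU`; nothing asserted about any curve.
[cite: CastellaHsieh2018, Prop. 3.6] [cite: Castella2018, Thm. 3.1 (arXiv:1704.06608 p. 9)] -/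
theorem exists_intFrame_span_le_of_branchFrame_of_multiplier (hp2 : p ≠ 2)
    (hK : Algebra.IsUnramifiedIn (𝓞 K) (Ideal.span {(p : ℤ)}))
    {N N' : ℕ} (f : CuspForm (Gamma0 N) 2) (f' : CuspForm (Gamma0 N') 2)
    (hcoef : ∀ ℓ : ℕ, ℓ.Prime → ℓ ≠ p → cuspCoeff f ℓ = ((legendreSym p ℓ : ℤ) : ℂ) * cuspCoeff f' ℓ)
    (hap : cuspCoeff f p = 0) (hpN : p ∣ N) (hlev : ∀ ℓ : ℕ, ℓ.Prime → ℓ ≠ p → (ℓ ∣ N ↔ ℓ ∣ N'))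
    {ι : PadicAlgCl p ≃+* ℂ} {𝔮 : HeightOneSpectrum (𝓞 K)} {κ : ZpExtension K p} {γ : Field.absoluteGaloisGroup K}
    (hγ : κ.IsTopGenerator γ) {e ΩK : ℂ} {Ωp Ωp' : ℂ_[p]} {L : UnrSeries p} {U : PowerSeries 𝓞_ℂ_[p]}
    (hΩK : ΩK ≠ 0) (hΩp' : Ωp' ≠ 0)
    (hL : IsBranchBDPLFunction ι 𝔮 κ γ f' (genusHeckeCharacter K p) e ΩK Ωp L)
    (hU : ∀ (φ : HeckeCharacter K) (n : ℕ), 0 < n → (∀ v : HeightOneSpectrum (𝓞 K), φ.IsUnramifiedAt v) →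
      φ.HasInfinityType (fun _ ↦ (n : ℤ)) (fun _ ↦ -(n : ℤ)) →
      ∀ r : FramedGaloisRep K (PadicAlgCl p) 1, IsPAdicAvatarOf ι φ r → FactorsThroughZp κ r →
        ∃ w : ℂ_[p], IntSeries.HasValueAt U (avatarValueAt r γ - 1) w ∧
          w * ((((ι.symm (e * (heckeValueExtZero φ 𝔮 ^ 2)⁻¹) : PadicAlgCl p)) : ℂ_[p]) * Ωp ^ (4 * n)) =
            Ωp' ^ (4 * n))
    {I : Ideal (IwasawaAlgebra p)} (hI : Ideal.span {L} ≤ I.map (PowerSeries.map (toUnr p))) :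
    ∃ (ΩK₀ : ℂ) (Ωp₀ : ℂ_[p]) (Q : PowerSeries 𝓞_ℂ_[p]), ΩK₀ ≠ 0 ∧ Ωp₀ ≠ 0 ∧
      R1.IsBDPLFunctionInt p ι 𝔮 κ γ f ΩK₀ Ωp₀ Q ∧ Ideal.span {Q} ≤ I.map (PowerSeries.map (R1.toCpInt p)) :=
  ⟨ΩK, Ωp', U * PowerSeries.map (R1.unrToCpInt p) L, hΩK, hΩp',
    isBDPLFunctionInt_mul_map_of_isBranchBDPLFunction_of_multiplier K hp2 hK f f' hcoef hap hpN hlev hγ hL hU,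
    span_mul_le_of_span_le (span_le_map_toCpInt_of_span_le_map_toUnr hI)⟩

end Summit.BirchSwinnertonDyer.BirchSwinnertonDyer.Theorems.SchneiderFreeAdditiveX3.ControlDischarged

end
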